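import Summits.HodgeConjecture.CorCM.MumfordTateRankDuplicateFactor
import Summits.HodgeConjecture.CorCM.MumfordTateRankRigidIsogenyInvariance
import Literature.AlgebraicGeometry.Motives.HodgeLieRigidDuplicateSummand
import HarnessLib

/-!
# Multiplicities keep `Θ`-rigidity: `H¹(A × B)` rigid ⟹ `H¹((A × B) × B)` rigid ⟹ `H¹(X)` rigid for every `X ∼ (A × B) × B`
# (Moonen–Zarhin §1 «`Hg(X × B) = Hg(X)` for a factor `B` of `X`», rigidity reading)

COR-CM (cell `pub-hodgecm2`, seat `b27` gen 54, count-neutral Mumford–Tate-rank ladder; theorems only, no definition, no named fact; UNCONDITIONAL —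
nothing here uses or asserts HC_CM).  The ladderʼs rigidity statements are about `H¹` of abelian varieties given UP TO ISOGENY and are used as
FACTORS; multiplicities of a factor must therefore not matter.  `Motives/HodgeLieRigidDuplicateSummand` (gen 54): a duplicate summand keeps
`Θ`-rigidity; here the abelian-variety reading through the Künneth bicones of `CorCM/MumfordTateRankDuplicateFactor` and the isogeny transport
`CorCM/MumfordTateRankRigidIsogenyInvariance`.
* **`hodgeLie_rigid_prod_prod_self_of_rigid`** — `H¹(A × B)` `Θ`-rigid ⟹ `H¹((A × B) × B)` `Θ`-rigid;
* **`hodgeLie_rigid_of_isIsogenous_prod_prod_self`** — … ⟹ `H¹(X)` `Θ`-rigid for every `X ∼ (A × B) × B`.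

## References
* [MoonenZarhin1999LowDim] B. Moonen, Yu. G. Zarhin, *Hodge classes on abelian varieties of low dimension*, Math. Ann. 315 (1999), §1 and §3 (3.1)
  [corpus: paper:arxiv-math_9901113 pp. 2, 6]. [cite: MoonenZarhin1999LowDim, §1 and §3]
* [Moonen1999MTNotes] B. Moonen, *Notes on Mumford–Tate groups* (1999), (1.7), (1.8), (1.13). [cite: Moonen1999MTNotes, (1.8) and (1.13)]
-/

noncomputable section

open scoped TensorProduct
open CategoryTheory CategoryTheory.Limits Module

namespace Summit.HodgeConjecture.CorCM

open Literature.AlgebraicGeometry.Motives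
open Literature.AlgebraicGeometry.Motives.AbelianVariety
open Literature.AlgebraicGeometry.Motives.HodgeStructure
open Literature.AlgebraicGeometry.HodgeTheory

variable [HodgeTensorFacts.{0, 0}] {X : AbelianVariety ℂ} {n : ℕ}

/-- **`H¹(A × B)` `Θ`-rigid ⟹ `H¹((A × B) × B)` `Θ`-rigid** (`H¹(B)` is a duplicate summand: `rigid_of_duplicate_summand` on the Künneth bicones).
[cite: MoonenZarhin1999LowDim, §1 and §3] [cite: Moonen1999MTNotes, (1.8) and (1.13)] -/
theorem hodgeLie_rigid_prod_prod_self_of_rigid {A B : AbelianVariety ℂ} {m m' : ℕ} (hP : IsSmoothProjective m ((A.prod B).prod B).X)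
    (hP' : IsSmoothProjective m' (A.prod B).X)
    (hrig : haveI := BettiUniverse.finite hP' 1
      ∀ 𝔟 : Submodule ℚ (Module.End ℚ (bettiCohomology (A.prod B).X 1)),
        𝔟 ≤ (BettiUniverse.hodge exists_isReal_hodgeModel_holds hP' 1).hodgeLie →
        (∀ X' ∈ 𝔟, ∀ Y ∈ 𝔟, X' * Y - Y * X' ∈ 𝔟) →
        (∃ Θ ∈ Submodule.span ℂ ((fun X' : Module.End ℚ (bettiCohomology (A.prod B).X 1) => X'.baseChange ℂ) ''
            (𝔟 : Set (Module.End ℚ (bettiCohomology (A.prod B).X 1)))),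
          ∀ p, ∀ x ∈ (BettiUniverse.hodge exists_isReal_hodgeModel_holds hP' 1).piece p (((1 : ℕ) : ℤ) - p),
            Θ x = ((2 * p - ((1 : ℕ) : ℤ) : ℤ) : ℂ) • x) →
        (BettiUniverse.hodge exists_isReal_hodgeModel_holds hP' 1).hodgeLie ≤ 𝔟) :
    haveI := BettiUniverse.finite hP 1
    ∀ 𝔞 : Submodule ℚ (Module.End ℚ (bettiCohomology ((A.prod B).prod B).X 1)),
      𝔞 ≤ (BettiUniverse.hodge exists_isReal_hodgeModel_holds hP 1).hodgeLie →
      (∀ X' ∈ 𝔞, ∀ Y ∈ 𝔞, X' * Y - Y * X' ∈ 𝔞) →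
      (∃ Θ ∈ Submodule.span ℂ ((fun X' : Module.End ℚ (bettiCohomology ((A.prod B).prod B).X 1) => X'.baseChange ℂ) ''
          (𝔞 : Set (Module.End ℚ (bettiCohomology ((A.prod B).prod B).X 1)))),
        ∀ p, ∀ x ∈ (BettiUniverse.hodge exists_isReal_hodgeModel_holds hP 1).piece p (((1 : ℕ) : ℤ) - p),
          Θ x = ((2 * p - ((1 : ℕ) : ℤ) : ℤ) : ℂ) • x) →
      (BettiUniverse.hodge exists_isReal_hodgeModel_holds hP 1).hodgeLie ≤ 𝔞 := by
  classical
  have hA : IsSmoothProjective A.dim A.X := AbelianVariety.isSmoothProjective_holds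
  have hB : IsSmoothProjective B.dim B.X := AbelianVariety.isSmoothProjective_holds
  haveI := BettiUniverse.finite hP 1
  haveI := BettiUniverse.finite hP' 1
  haveI := BettiUniverse.finite hA 1
  haveI := BettiUniverse.finite hB 1
  -- the bicone of `H¹(A × B)`
  let ι₁' := BettiUniverse.pullHodgeHom exists_isReal_hodgeModel_holds hodgePQ_independent_of_hodgeModel_holds hP' hA
    (fst A B).hom.hom.hom 1
  let π₁' := BettiUniverse.pullHodgeHom exists_isReal_hodgeModel_holds hodgePQ_independent_of_hodgeModel_holds hA hP'
    (prodLift (𝟙 A) (0 : A ⟶ B)).hom.hom.hom 1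
  let ι₂' := BettiUniverse.pullHodgeHom exists_isReal_hodgeModel_holds hodgePQ_independent_of_hodgeModel_holds hP' hB
    (snd A B).hom.hom.hom 1
  let π₂' := BettiUniverse.pullHodgeHom exists_isReal_hodgeModel_holds hodgePQ_independent_of_hodgeModel_holds hB hP'
    (prodLift (0 : B ⟶ A) (𝟙 B)).hom.hom.hom 1
  have hsumP' : fst A B ≫ prodLift (𝟙 A) (0 : A ⟶ B) + snd A B ≫ prodLift (0 : B ⟶ A) (𝟙 B) = 𝟙 _ := by
    refine prod_hom_ext ?_ ?_
    · rw [Preadditive.add_comp, Category.assoc, Category.assoc, prodLift_fst, prodLift_fst, Category.comp_id,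
        comp_zero, add_zero, Category.id_comp]
    · rw [Preadditive.add_comp, Category.assoc, Category.assoc, prodLift_snd, prodLift_snd, Category.comp_id,
        comp_zero, zero_add, Category.id_comp]
  have hπι₁' : ∀ v, π₁'.toLinearMap (ι₁'.toLinearMap v) = v := fun v => pull_pull_eq_self_of_comp_eq_id (prodLift_fst _ _) v
  have hπι₂' : ∀ v, π₂'.toLinearMap (ι₂'.toLinearMap v) = v := fun v => pull_pull_eq_self_of_comp_eq_id (prodLift_snd _ _) v
  have hsum' : ∀ v, ι₁'.toLinearMap (π₁'.toLinearMap v) + ι₂'.toLinearMap (π₂'.toLinearMap v) = v := fun v =>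
    pull_pull_add_pull_pull_eq_self _ _ _ _ hsumP' v
  -- the bicone of `H¹((A × B) × B)`
  let ι₀ := BettiUniverse.pullHodgeHom exists_isReal_hodgeModel_holds hodgePQ_independent_of_hodgeModel_holds hP hP'
    (fst (A.prod B) B).hom.hom.hom 1
  let π₀ := BettiUniverse.pullHodgeHom exists_isReal_hodgeModel_holds hodgePQ_independent_of_hodgeModel_holds hP' hP
    (prodLift (𝟙 (A.prod B)) (0 : A.prod B ⟶ B)).hom.hom.hom 1
  let ι₃ := BettiUniverse.pullHodgeHom exists_isReal_hodgeModel_holds hodgePQ_independent_of_hodgeModel_holds hP hB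
    (snd (A.prod B) B).hom.hom.hom 1
  let π₃ := BettiUniverse.pullHodgeHom exists_isReal_hodgeModel_holds hodgePQ_independent_of_hodgeModel_holds hB hP
    (prodLift (0 : B ⟶ A.prod B) (𝟙 B)).hom.hom.hom 1
  have hsumP : fst (A.prod B) B ≫ prodLift (𝟙 (A.prod B)) (0 : A.prod B ⟶ B) +
      snd (A.prod B) B ≫ prodLift (0 : B ⟶ A.prod B) (𝟙 B) = 𝟙 _ := by
    refine prod_hom_ext ?_ ?_
    · rw [Preadditive.add_comp, Category.assoc, Category.assoc, prodLift_fst, prodLift_fst, Category.comp_id,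
        comp_zero, add_zero, Category.id_comp]
    · rw [Preadditive.add_comp, Category.assoc, Category.assoc, prodLift_snd, prodLift_snd, Category.comp_id,
        comp_zero, zero_add, Category.id_comp]
  have hπι₀ : ∀ v, π₀.toLinearMap (ι₀.toLinearMap v) = v := fun v => pull_pull_eq_self_of_comp_eq_id (prodLift_fst _ _) v
  have hπι₃ : ∀ v, π₃.toLinearMap (ι₃.toLinearMap v) = v := fun v => pull_pull_eq_self_of_comp_eq_id (prodLift_snd _ _) v
  have hsum : ∀ v, ι₀.toLinearMap (π₀.toLinearMap v) + ι₃.toLinearMap (π₃.toLinearMap v) = v := fun v =>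
    pull_pull_add_pull_pull_eq_self _ _ _ _ hsumP v
  exact rigid_of_duplicate_summand ι₁' π₁' ι₂' π₂' hπι₁' hπι₂' hsum' ι₀ π₀ ι₃ π₃ hπι₀ hπι₃ hsum hrig

/-- **`H¹(X)` is `Θ`-rigid for every `X ∼ (A × B) × B` once `H¹(A × B)` is** (isogeny transport `hodgeLie_rigid_of_isIsogenous`).
[cite: MoonenZarhin1999LowDim, §1 and §3] [cite: Moonen1999MTNotes, (1.8) and (1.13)] -/
theorem hodgeLie_rigid_of_isIsogenous_prod_prod_self (hX : IsSmoothProjective n X.X) {A B : AbelianVariety ℂ} {m' : ℕ}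
    (hP' : IsSmoothProjective m' (A.prod B).X)
    (hrig : haveI := BettiUniverse.finite hP' 1
      ∀ 𝔟 : Submodule ℚ (Module.End ℚ (bettiCohomology (A.prod B).X 1)),
        𝔟 ≤ (BettiUniverse.hodge exists_isReal_hodgeModel_holds hP' 1).hodgeLie →
        (∀ X' ∈ 𝔟, ∀ Y ∈ 𝔟, X' * Y - Y * X' ∈ 𝔟) →
        (∃ Θ ∈ Submodule.span ℂ ((fun X' : Module.End ℚ (bettiCohomology (A.prod B).X 1) => X'.baseChange ℂ) ''
            (𝔟 : Set (Module.End ℚ (bettiCohomology (A.prod B).X 1)))),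
          ∀ p, ∀ x ∈ (BettiUniverse.hodge exists_isReal_hodgeModel_holds hP' 1).piece p (((1 : ℕ) : ℤ) - p),
            Θ x = ((2 * p - ((1 : ℕ) : ℤ) : ℤ) : ℂ) • x) →
        (BettiUniverse.hodge exists_isReal_hodgeModel_holds hP' 1).hodgeLie ≤ 𝔟)
    (hXP : IsIsogenous X ((A.prod B).prod B)) :
    haveI := BettiUniverse.finite hX 1
    ∀ 𝔞 : Submodule ℚ (Module.End ℚ (bettiCohomology X.X 1)),
      𝔞 ≤ (BettiUniverse.hodge exists_isReal_hodgeModel_holds hX 1).hodgeLie →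
      (∀ X' ∈ 𝔞, ∀ Y ∈ 𝔞, X' * Y - Y * X' ∈ 𝔞) →
      (∃ Θ ∈ Submodule.span ℂ ((fun X' : Module.End ℚ (bettiCohomology X.X 1) => X'.baseChange ℂ) ''
          (𝔞 : Set (Module.End ℚ (bettiCohomology X.X 1)))),
        ∀ p, ∀ x ∈ (BettiUniverse.hodge exists_isReal_hodgeModel_holds hX 1).piece p (((1 : ℕ) : ℤ) - p),
          Θ x = ((2 * p - ((1 : ℕ) : ℤ) : ℤ) : ℂ) • x) →
      (BettiUniverse.hodge exists_isReal_hodgeModel_holds hX 1).hodgeLie ≤ 𝔞 := by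
  have hP : IsSmoothProjective ((A.prod B).prod B).dim ((A.prod B).prod B).X := AbelianVariety.isSmoothProjective_holds
  exact hodgeLie_rigid_of_isIsogenous hP hX hXP.symm' (hodgeLie_rigid_prod_prod_self_of_rigid hP hP' hrig)

end Summit.HodgeConjecture.CorCM

end
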